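import Literature.NumberTheory.Automorphic.UnramifiedOrbitSetSplit
import HarnessLib

/-!
# Kottwitz's orbit lemma for `U(J)(F_v)` at the NON-SPLIT places: reduction to the one-place unitary orbit lemma over the local field `E_w`,
# and the assembly «split ∨ non-split» at almost every place
(Kottwitz, *Stable trace formula: elliptic singular terms* (1986), Prop. 7.1 ∕ Cor. 7.3; Rogawski (1990), §3.3 p. 21, §4.3 p. 44;
Platonov–Rapinchuk (1994), §5.1)

Topic `NumberTheory/Automorphic`; namespace `Literature.NumberTheory.Automorphic.UnitaryGroup`; THEOREMS ONLY (no definition, no instance, no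
named fact, no `sorry`).  Third repayment instalment of ★-to-be `UnitaryGroup.UnramifiedOrbitSetAE` (`Automorphic/UnramifiedOrbitalUnitFactor`),
companion of ★ `UnramifiedOrbitSetSplit` (the split places, PROVED there).  At a NON-split place `v` of `F` (`c • w = w`, one place `w ∣ v`) the local
group is the genuine unitary group `U(σ_w, J_w)(E_w)` of the quadratic extension `E_w ⊃ F_v` of local fields (★ `localNonsplitEquiv`, ★
`mem_localIntegralLevel_iff_of_smul_eq`: `U(J)(𝒪_v) ↔ U(σ_w, J_w)(E_w) ∩ GL_N(𝒪_w)`), and Kottwitz's lemma there is the `GL_N` statement (★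
`IntegralConjugacyOfRegularElements`) PLUS the unitary correction — norm surjectivity `a ↦ a a^*` on the units of the commutant order `𝒪_w[γ_w]`
at the UNRAMIFIED places ([Kottwitz1986, Prop. 7.1]; F2 of the census, in flight: ★ `UnramifiedQuadraticNorm…`).  This file does the TRANSPORT and
the ALMOST-EVERYWHERE bookkeeping, taking the ONE-PLACE UNITARY ORBIT LEMMA as an explicit hypothesis `hlocal` (its printed shape: for `v` unramified in
`E`, `J_w ∈ GL_N(𝒪_w)`, `γ_w ∈ U(σ_w, J_w)(E_w) ∩ GL_N(𝒪_w)` with characteristic polynomial separable modulo `𝔪_w`: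
`∀ y ∈ U(σ_w,J_w)(E_w), y γ_w y⁻¹ ∈ GL_N(𝒪_w) → y ∈ (U ∩ GL_N(𝒪_w)) · Z_U(γ_w)`), so that the named fact becomes a COROLLARY of that local lemma:

* §1 `orbitSet_of_nonsplit` — transport of the orbit-set property from the one-place model `U(σ_w, J_w)(E_w)` (level `glInt` pulled back) to
  `U(J)(F_v)` (level ★ `localIntegralLevel`) along ★ `localNonsplitEquiv` (★ `orbitSet_of_mulEquiv`); `localNonsplitEquiv_eq_map_of_eq_toLocalGL`
  (`γ ⊗ 1 ↦ γ` read in `GL_N(E_w)`).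
* §2 **`eventually_forall_orbitSet_of_nonsplit_of_local`** — for `c ≠ 1`, `J` with `det J` a unit, `γ ∈ GL_N(E)` with separable
  characteristic polynomial and `γ ⊗ 1 ∈ U(J)(F_v)` for all `v` (elements `g v`): the one-place lemma `hlocal` (quantified over the unramified
  non-split places with `J_w ∈ GL_N(𝒪_w)`) implies the orbit-set property at `g v` for almost every `v` and every non-split `w ∣ v` (exceptional
  places: ramified — `finite_setOf_not_isUnramifiedIn`, private copy of ★ B9's — `J_w` or `γ_w` not in `GL_N(𝒪_w)`, no separable integral model).
* §3 **`eventually_orbitSet_of_local`** — SPLIT ∨ NON-SPLIT: with ★ `eventually_forall_orbitSet_of_split`, for almost every `v` the orbit-set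
  property holds at `g v` outright (every `v` has a place `w ∣ v`, split or not).
* §4 CM dress: **`eventually_orbitSet_cmDatum_of_local`** — for `H` hermitian with `det H ≠ 0` and a regular rational `γ ∈ U(H)(L⁺)`:
  `hlocal → ∀ᶠ v, ∀ y : (cmDatum L N H).Local v, y γ_v y⁻¹ ∈ K_v → y ∈ K_v · Z(γ_v)` — the body of `UnramifiedOrbitSetAE L N H` at `γ`, so the
  named fact for hermitian non-degenerate `H` is EXACTLY the one-place unitary orbit lemma at the unramified inert places.

## References
* R. E. Kottwitz, *Stable trace formula: elliptic singular terms*, Math. Ann. 275 (1986), §7, Prop. 7.1, Cor. 7.3 [Kottwitz1986].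
* J. D. Rogawski, *Automorphic Representations of Unitary Groups in Three Variables*, Ann. of Math. Stud. 123 (1990), §3.3 p. 21, §4.3 p. 44 (print)
  [Rogawski1990].
* V. Platonov, A. Rapinchuk, *Algebraic Groups and Number Theory* (1994), §5.1 [PlatonovRapinchuk1994].
-/

set_option autoImplicit false

noncomputable section

open NumberField IsDedekindDomain Filter Polynomial
open scoped Matrix Pointwise

namespace Literature.NumberTheory.Automorphic.UnitaryGroup

section Generic

variable {F E : Type} [Field F] [NumberField F] [Field E] [NumberField E] [Algebra F E]
  (c : E ≃ₐ[F] E) (N : ℕ) (J : Matrix (Fin N) (Fin N) E)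

/-- Only finitely many places of `F` ramify in `E` (private copy of ★ B9's lemma: the ramified places lie below the prime factors of the
different). [cite: PlatonovRapinchuk1994, §5.1] -/
private theorem finite_setOf_not_isUnramifiedIn :
    {v : HeightOneSpectrum (𝓞 F) | ¬ Algebra.IsUnramifiedIn (𝓞 E) v.asIdeal}.Finite := by
  have hD : differentIdeal (𝓞 F) (𝓞 E) ≠ ⊥ := differentIdeal_ne_bot
  have hfin : {Q : HeightOneSpectrum (𝓞 E) | Q.asIdeal ∣ differentIdeal (𝓞 F) (𝓞 E)}.Finite :=
    Ideal.finite_factors hD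
  refine (hfin.image fun Q => Q.under (𝓞 F)).subset ?_
  intro q hq
  simp only [Set.mem_setOf_eq, Algebra.IsUnramifiedIn, not_forall] at hq
  obtain ⟨Q, hQprime, hQover, hQunr⟩ := hq
  haveI := hQprime
  have hQne : Q ≠ ⊥ := Ideal.ne_bot_of_liesOver_of_ne_bot q.ne_bot Q
  refine ⟨⟨Q, hQprime, hQne⟩, ?_, ?_⟩
  · exact dvd_differentIdeal_iff.mpr hQunr
  · exact HeightOneSpectrum.ext hQover.over.symm

variable [Algebra.IsQuadraticExtension F E] {v : HeightOneSpectrum (𝓞 F)}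

/-! ## §1 Transport from the one-place model at a non-split place -/

/-- **`localNonsplitEquiv (γ ⊗ 1) = γ` in `GL_N(E_w)`**: for `g ∈ U(J)(F_v)` with `(g : GL_N(E ⊗ F_v)) = γ ⊗ 1` (★ `toLocalGL`), the one-place
model sends `g` to `γ` read in `GL_N(E_w)` (the `w`-component, ★ `coe_localPiNonsplitEquiv_apply`). [cite: PlatonovRapinchuk1994, §5.1] -/
theorem localNonsplitEquiv_eq_map_of_eq_toLocalGL (hc : c ≠ 1) (w : PlacesOver E v) (hw : c • w.1 = w.1) (γ : GL (Fin N) E)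
    (g : «local» E c N J v) (hg : (g : GL (Fin N) (LocalRing E v)) = toLocalGL E v γ) :
    ((localNonsplitEquiv c J hc w hw g : unitaryGroupOfForm (galAdicCompletionMap (L := E) c hw) (placeForm J w.1)) :
        GL (Fin N) (w.1.adicCompletion E)) = Matrix.GeneralLinearGroup.map (algebraMap E (w.1.adicCompletion E)) γ := by
  refine Units.ext ?_
  change (((g : GL (Fin N) (LocalRing E v)) : Matrix (Fin N) (Fin N) (LocalRing E v)).map
      (Pi.evalRingHom (fun w' : PlacesOver E v => w'.1.adicCompletion E) w)) = _
  rw [hg, coe_toLocalGL_apply, Matrix.map_map]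
  rfl

/-- **Kottwitz's orbit lemma at a non-split place, transported from the one-place model.**  If the orbit-set property holds in
`U(σ_w, J_w)(E_w)` at `g_w = localNonsplitEquiv g` for the level `U ∩ GL_N(𝒪_w)` (★ `glInt` pulled back), then it holds in `U(J)(F_v)` at `g` for the
level `U(J)(𝒪_v)` (★ `localIntegralLevel`; ★ `mem_localIntegralLevel_iff_of_smul_eq`). [cite: Kottwitz1986, Prop. 7.1] -/
theorem orbitSet_of_nonsplit (hc : c ≠ 1) (w : PlacesOver E v) (hw : c • w.1 = w.1) (g : «local» E c N J v)
    (hcore : ∀ y' : unitaryGroupOfForm (galAdicCompletionMap (L := E) c hw) (placeForm J w.1),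
      ((y' * localNonsplitEquiv c J hc w hw g * y'⁻¹ : unitaryGroupOfForm (galAdicCompletionMap (L := E) c hw) (placeForm J w.1)) :
          GL (Fin N) (w.1.adicCompletion E)) ∈ glInt N (w.1.adicCompletion E) →
        y' ∈ ((glInt N (w.1.adicCompletion E)).subgroupOf (unitaryGroupOfForm (galAdicCompletionMap (L := E) c hw) (placeForm J w.1)) :
            Set (unitaryGroupOfForm (galAdicCompletionMap (L := E) c hw) (placeForm J w.1))) *
          (Subgroup.centralizer ({localNonsplitEquiv c J hc w hw g} :
              Set (unitaryGroupOfForm (galAdicCompletionMap (L := E) c hw) (placeForm J w.1))) :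
            Set (unitaryGroupOfForm (galAdicCompletionMap (L := E) c hw) (placeForm J w.1)))) :
    ∀ y : «local» E c N J v, y * g * y⁻¹ ∈ localIntegralLevel c N J v →
      y ∈ (localIntegralLevel c N J v : Set («local» E c N J v)) * (Subgroup.centralizer ({g} : Set («local» E c N J v)) : Set («local» E c N J v)) :=
  orbitSet_of_mulEquiv (localNonsplitEquiv c J hc w hw).toMulEquiv (localIntegralLevel c N J v)
    ((glInt N (w.1.adicCompletion E)).subgroupOf (unitaryGroupOfForm (galAdicCompletionMap (L := E) c hw) (placeForm J w.1)))
    (fun g' => by rw [Subgroup.mem_subgroupOf]; exact mem_localIntegralLevel_iff_of_smul_eq c N J hc w hw g') g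
    (fun y' hy' => hcore y' (by rw [Subgroup.mem_subgroupOf] at hy'; exact hy'))

/-! ## §2 Almost every place, every non-split place over it — modulo the one-place unitary orbit lemma -/

/-- **The non-split half, reduced to the ONE-PLACE UNITARY ORBIT LEMMA.**  For `c ≠ 1`, `J` with `det J` a unit, `γ ∈ GL_N(E)` with
separable characteristic polynomial and `γ ⊗ 1 ∈ U(J)(F_v)` for all `v` (elements `g v`), ASSUME the local lemma `hlocal`: at every `v` unramified in `E`
and every non-split `w ∣ v` with `J_w ∈ GL_N(𝒪_w)`, for every `γ_w ∈ U(σ_w, J_w)(E_w) ∩ GL_N(𝒪_w)` whose characteristic polynomial has an integral model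
separable modulo `𝔪_w`, `∀ y ∈ U(σ_w, J_w)(E_w), y γ_w y⁻¹ ∈ GL_N(𝒪_w) → y ∈ (U ∩ GL_N(𝒪_w)) · Z_U(γ_w)` [Kottwitz1986, Prop. 7.1 for the unramified
unitary group].  THEN for all but finitely many `v`, at every non-split `w ∣ v`, `∀ y ∈ U(J)(F_v), y (γ ⊗ 1) y⁻¹ ∈ U(J)(𝒪_v) → y ∈ U(J)(𝒪_v) · Z(γ ⊗ 1)`.
[cite: Kottwitz1986, Prop. 7.1; Cor. 7.3] -/
theorem eventually_forall_orbitSet_of_nonsplit_of_local (hc : c ≠ 1) (hJ : IsUnit J.det) (γ : GL (Fin N) E)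
    (hγ : ((γ : Matrix (Fin N) (Fin N) E).charpoly).Separable) (g : ∀ v : HeightOneSpectrum (𝓞 F), «local» E c N J v)
    (hg : ∀ v, (g v : GL (Fin N) (LocalRing E v)) = toLocalGL E v γ)
    (hlocal : ∀ (v : HeightOneSpectrum (𝓞 F)) (w : PlacesOver E v) (hw : c • w.1 = w.1), Algebra.IsUnramifiedIn (𝓞 E) v.asIdeal →
      (isUnit_placeForm J ((Matrix.isUnit_iff_isUnit_det J).2 hJ) w.1).unit ∈ glInt N (w.1.adicCompletion E) →
      ∀ γw : unitaryGroupOfForm (galAdicCompletionMap (L := E) c hw) (placeForm J w.1),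
        (γw : GL (Fin N) (w.1.adicCompletion E)) ∈ glInt N (w.1.adicCompletion E) →
        (∃ q : (w.1.adicCompletionIntegers E)[X],
          q.map (w.1.adicCompletionIntegers E).subtype =
              (((γw : GL (Fin N) (w.1.adicCompletion E)) : Matrix (Fin N) (Fin N) (w.1.adicCompletion E))).charpoly ∧
            (q.map (IsLocalRing.residue (w.1.adicCompletionIntegers E))).Separable) →
        ∀ y : unitaryGroupOfForm (galAdicCompletionMap (L := E) c hw) (placeForm J w.1),
          ((y * γw * y⁻¹ : unitaryGroupOfForm (galAdicCompletionMap (L := E) c hw) (placeForm J w.1)) :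
              GL (Fin N) (w.1.adicCompletion E)) ∈ glInt N (w.1.adicCompletion E) →
            y ∈ ((glInt N (w.1.adicCompletion E)).subgroupOf (unitaryGroupOfForm (galAdicCompletionMap (L := E) c hw) (placeForm J w.1)) :
                Set (unitaryGroupOfForm (galAdicCompletionMap (L := E) c hw) (placeForm J w.1))) *
              (Subgroup.centralizer ({γw} : Set (unitaryGroupOfForm (galAdicCompletionMap (L := E) c hw) (placeForm J w.1))) :
                Set (unitaryGroupOfForm (galAdicCompletionMap (L := E) c hw) (placeForm J w.1)))) :
    ∀ᶠ v : HeightOneSpectrum (𝓞 F) in cofinite, ∀ w : PlacesOver E v, ∀ hw : c • w.1 = w.1,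
      ∀ y : «local» E c N J v, y * g v * y⁻¹ ∈ localIntegralLevel c N J v →
        y ∈ (localIntegralLevel c N J v : Set («local» E c N J v)) *
          (Subgroup.centralizer ({g v} : Set («local» E c N J v)) : Set («local» E c N J v)) := by
  have hJu : IsUnit J := (Matrix.isUnit_iff_isUnit_det J).2 hJ
  filter_upwards [eventually_forall_unit_placeForm_mem_glInt (F := F) N J hJu, eventually_forall_map_mem_glInt F E γ,
    eventually_forall_placesOver E (eventually_exists_separable_lift ((γ : Matrix (Fin N) (Fin N) E).charpoly) hγ),
    (finite_setOf_not_isUnramifiedIn (F := F) (E := E)).compl_mem_cofinite] with v hint hγint hsep hunr w hw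
  have hv : Algebra.IsUnramifiedIn (𝓞 E) v.asIdeal := not_not.1 hunr
  refine orbitSet_of_nonsplit c N J hc w hw (g v) ?_
  have he : ((localNonsplitEquiv c J hc w hw (g v) : unitaryGroupOfForm (galAdicCompletionMap (L := E) c hw) (placeForm J w.1)) :
      GL (Fin N) (w.1.adicCompletion E)) = Matrix.GeneralLinearGroup.map (algebraMap E (w.1.adicCompletion E)) γ :=
    localNonsplitEquiv_eq_map_of_eq_toLocalGL c N J hc w hw γ (g v) (hg v)
  obtain ⟨q, hq, hqsep⟩ := hsep w
  refine hlocal v w hw hv (hint w) _ (by rw [he]; exact hγint w) ⟨q, ?_, hqsep.map⟩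
  rw [hq, he, ← Matrix.charpoly_map]
  rfl

/-! ## §3 Split ∨ non-split: the orbit-set property at almost every place, modulo the one-place unitary orbit lemma -/

/-- **Kottwitz's orbit lemma at almost every place of `F`, modulo the one-place unitary orbit lemma at the inert places**: every `v` has a place
`w ∣ v` of `E`, split (★ `eventually_forall_orbitSet_of_split`, proved outright) or not (§2). [cite: Kottwitz1986, Prop. 7.1; Cor. 7.3] -/
theorem eventually_orbitSet_of_local (hc : c ≠ 1) (hJh : (J.map c)ᵀ = J) (hJ : IsUnit J.det) (γ : GL (Fin N) E)
    (hγ : ((γ : Matrix (Fin N) (Fin N) E).charpoly).Separable) (g : ∀ v : HeightOneSpectrum (𝓞 F), «local» E c N J v)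
    (hg : ∀ v, (g v : GL (Fin N) (LocalRing E v)) = toLocalGL E v γ)
    (hlocal : ∀ (v : HeightOneSpectrum (𝓞 F)) (w : PlacesOver E v) (hw : c • w.1 = w.1), Algebra.IsUnramifiedIn (𝓞 E) v.asIdeal →
      (isUnit_placeForm J ((Matrix.isUnit_iff_isUnit_det J).2 hJ) w.1).unit ∈ glInt N (w.1.adicCompletion E) →
      ∀ γw : unitaryGroupOfForm (galAdicCompletionMap (L := E) c hw) (placeForm J w.1),
        (γw : GL (Fin N) (w.1.adicCompletion E)) ∈ glInt N (w.1.adicCompletion E) →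
        (∃ q : (w.1.adicCompletionIntegers E)[X],
          q.map (w.1.adicCompletionIntegers E).subtype =
              (((γw : GL (Fin N) (w.1.adicCompletion E)) : Matrix (Fin N) (Fin N) (w.1.adicCompletion E))).charpoly ∧
            (q.map (IsLocalRing.residue (w.1.adicCompletionIntegers E))).Separable) →
        ∀ y : unitaryGroupOfForm (galAdicCompletionMap (L := E) c hw) (placeForm J w.1),
          ((y * γw * y⁻¹ : unitaryGroupOfForm (galAdicCompletionMap (L := E) c hw) (placeForm J w.1)) :
              GL (Fin N) (w.1.adicCompletion E)) ∈ glInt N (w.1.adicCompletion E) →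
            y ∈ ((glInt N (w.1.adicCompletion E)).subgroupOf (unitaryGroupOfForm (galAdicCompletionMap (L := E) c hw) (placeForm J w.1)) :
                Set (unitaryGroupOfForm (galAdicCompletionMap (L := E) c hw) (placeForm J w.1))) *
              (Subgroup.centralizer ({γw} : Set (unitaryGroupOfForm (galAdicCompletionMap (L := E) c hw) (placeForm J w.1))) :
                Set (unitaryGroupOfForm (galAdicCompletionMap (L := E) c hw) (placeForm J w.1)))) :
    ∀ᶠ v : HeightOneSpectrum (𝓞 F) in cofinite,
      ∀ y : «local» E c N J v, y * g v * y⁻¹ ∈ localIntegralLevel c N J v →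
        y ∈ (localIntegralLevel c N J v : Set («local» E c N J v)) *
          (Subgroup.centralizer ({g v} : Set («local» E c N J v)) : Set («local» E c N J v)) := by
  filter_upwards [eventually_forall_orbitSet_of_split c N J hc hJh hJ γ hγ g hg,
    eventually_forall_orbitSet_of_nonsplit_of_local c N J hc hJ γ hγ g hg hlocal] with v hsplit hnonsplit
  obtain ⟨w⟩ := (inferInstance : Nonempty (PlacesOver E v))
  by_cases hw : c • w.1 = w.1
  · exact hnonsplit w hw
  · exact hsplit w hw

end Generic

/-! ## §4 The CM dress: the body of `UnramifiedOrbitSetAE L N H` at a regular rational `γ`, modulo the one-place lemma -/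

section CM

variable (L : Type) [Field L] [NumberField L] [IsCMField L] (N : ℕ) (H : Matrix (Fin N) (Fin N) L)

/-- **The named fact's body at `γ`, from the one-place unitary orbit lemma.**  For `H` hermitian with `det H ≠ 0` and a regular semisimple rational
`γ ∈ U(H)(L⁺)` (separable characteristic polynomial — ★ `IsRegularElt γ.val` unfolded): if Kottwitz's orbit lemma holds in the one-place unitary
groups `U(σ_w, H_w)(L_w)` at the unramified inert places with `H_w ∈ GL_N(𝒪_w)` (hypothesis `hlocal`, the shape of §2), then for all but finitely
many finite places `v` of `L⁺`, every `y ∈ U(H)(L⁺_v)` with `y γ_v y⁻¹ ∈ K_v = U(H)(𝒪_v)` lies in `K_v · Z(γ_v)` — the split places by ★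
`eventually_forall_orbitSet_cmDatum_of_split`, the others by §2. [cite: Kottwitz1986, Prop. 7.1; Cor. 7.3] [cite: Rogawski1990, §3.3 p. 21; §4.3 p. 44] -/
theorem eventually_orbitSet_cmDatum_of_local (hH : (H.map (cmConjRingHom L))ᵀ = H) (hHd : H.det ≠ 0)
    (γ : (cmDatum L N H).Rational) (hγ : (((γ.val : GL (Fin N) L) : Matrix (Fin N) (Fin N) L).charpoly).Separable)
    (hlocal : ∀ (v : HeightOneSpectrum (𝓞 ↥(maximalRealSubfield L))) (w : PlacesOver L v) (hw : IsCMField.complexConj L • w.1 = w.1),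
      Algebra.IsUnramifiedIn (𝓞 L) v.asIdeal →
      (isUnit_placeForm H ((Matrix.isUnit_iff_isUnit_det H).2 (isUnit_iff_ne_zero.2 hHd)) w.1).unit ∈ glInt N (w.1.adicCompletion L) →
      ∀ γw : unitaryGroupOfForm (galAdicCompletionMap (L := L) (IsCMField.complexConj L) hw) (placeForm H w.1),
        (γw : GL (Fin N) (w.1.adicCompletion L)) ∈ glInt N (w.1.adicCompletion L) →
        (∃ q : (w.1.adicCompletionIntegers L)[X],
          q.map (w.1.adicCompletionIntegers L).subtype =
              (((γw : GL (Fin N) (w.1.adicCompletion L)) : Matrix (Fin N) (Fin N) (w.1.adicCompletion L))).charpoly ∧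
            (q.map (IsLocalRing.residue (w.1.adicCompletionIntegers L))).Separable) →
        ∀ y : unitaryGroupOfForm (galAdicCompletionMap (L := L) (IsCMField.complexConj L) hw) (placeForm H w.1),
          ((y * γw * y⁻¹ : unitaryGroupOfForm (galAdicCompletionMap (L := L) (IsCMField.complexConj L) hw) (placeForm H w.1)) :
              GL (Fin N) (w.1.adicCompletion L)) ∈ glInt N (w.1.adicCompletion L) →
            y ∈ ((glInt N (w.1.adicCompletion L)).subgroupOf
                  (unitaryGroupOfForm (galAdicCompletionMap (L := L) (IsCMField.complexConj L) hw) (placeForm H w.1)) :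
                Set (unitaryGroupOfForm (galAdicCompletionMap (L := L) (IsCMField.complexConj L) hw) (placeForm H w.1))) *
              (Subgroup.centralizer ({γw} :
                  Set (unitaryGroupOfForm (galAdicCompletionMap (L := L) (IsCMField.complexConj L) hw) (placeForm H w.1))) :
                Set (unitaryGroupOfForm (galAdicCompletionMap (L := L) (IsCMField.complexConj L) hw) (placeForm H w.1)))) :
    ∀ᶠ v : HeightOneSpectrum (𝓞 ↥(maximalRealSubfield L)) in cofinite,
      ∀ y : (cmDatum L N H).Local v,
        y * (cmDatum L N H).toLocal v ((cmDatum L N H).toAdelic γ) * y⁻¹ ∈ cmLocalIntegralLevel L N H v →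
          y ∈ (cmLocalIntegralLevel L N H v : Set ((cmDatum L N H).Local v)) *
            (Subgroup.centralizer ({(cmDatum L N H).toLocal v ((cmDatum L N H).toAdelic γ)} : Set ((cmDatum L N H).Local v)) :
              Set ((cmDatum L N H).Local v)) :=
  eventually_orbitSet_of_local (IsCMField.complexConj L) N H (IsCMField.complexConj_ne_one L) hH (isUnit_iff_ne_zero.2 hHd)
    (γ.val : GL (Fin N) L) hγ (fun v => (cmDatum L N H).toLocal v ((cmDatum L N H).toAdelic γ))
    (fun v => coe_cmDatum_toLocal_toAdelic L N H v γ) hlocal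

end CM

end Literature.NumberTheory.Automorphic.UnitaryGroup

end
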